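/-
Copyright (c) 2026 the pub-hodgecm-mathlib formalisation cell (harness21).  Prover seat hodgecm-mathlib-K2Liu-p03 (g5): Track B «K2-LIT»,
#184♮ = hLiu418 = stmt-HodgeConjecture-24832; Road Φ of socket #41, organ Φ3c (LEAD F0P6-plan (g11) ruling «M-155l» (3c)).
-/
import Summits.HodgeConjecture.HodgeConjecture.Theorems.K2LiuSiegelUnipotentHaarPinned           -- Φ3b: the pinned splitting of `νN` (+ DEFS leaves 1–2)
import Literature.MeasureTheory.RestrictedProduct.ProductIntegralMonotone                        -- ★ Tate's Theorem 3.3.1 `tendsto_prod_integral_of_forall_rpBox`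
import Mathlib.MeasureTheory.Integral.Prod
import HarnessLib

/-!
# Crux `HLiu418`, Road Φ of socket #41, organ Φ3c: THE EULER PRODUCT OF A FACTORIZABLE INTEGRABLE FUNCTION ON `N_Δ(𝔸)`
# `∫_{N_Δ(𝔸)} G dνN = (∫_{N_Δ(L⁺⊗ℝ) × ∏_{v∈S} N_Δ(L⁺_v)} G_S) · ∏'_{v∉S} ∫_{N_Δ(L⁺_v)} G_v dν_v`

Cell `hodgecm-mathlib`, crux item hLiu418 = `stmt-HodgeConjecture-24832`, route of record `HCCMUnconditional`; squad K2 ∕ K2Liu, road `K2_Liu`,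
socket #41 `sig_K2LiuSiegelEisensteinContinuation`, Road Φ, organ Φ3c «generic Euler limit» (census `K2/K2Liu-p03/g5/CENSUS-PHI3-PureTensorEuler…md` §1
row Φ3c).  THEOREMS ONLY (no `def`, no instance, no notation, no named-fact hypothesis, no `sorry`); lane `--supports stmt-HodgeConjecture-24832`.
This is the `N_Δ(𝔸)`-twin of ★ #29s's generic core `K2LiuDoublingPartialEuler.integrable_and_integral_eq_tprod_mul_of_map_eq` MINUS the matrix
coefficient `Q`: `N_Δ(𝔸)` is commutative and the Fourier-coefficient integrand is an honest restricted tensor product, so the local step is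
`∫_{N_v} G_v dν_v` itself (no Hecke identity).

CONTENTS (namespace `…Cruxes.HLiu418.K2LiuSiegelUnipotentEulerProduct`).
* §1 GENERIC (pure measure theory on `X × Πʳ i, [G i, K i]`, `μ ⊗ ∏'(ν_i; K_i)` with `ν_i(K_i) = 1`): for `g : X → ℂ` and local factors `φ_i ≡ 1` on `K_i`,
  `finprod_eq_prod_of_mem_rpBox` (on the box `A_T` the restricted tensor product `y ↦ ∏ᶠ_i φ_i(y_i)` is the finite product over `T`),
  `hasProd_integral_of_integrable_finprod` (★ Tate 3.3.1, dominated form: `HasProd (i ↦ ∫ φ_i dν_i) (∫ ∏ᶠ φ_i d∏'ν)` when the tensor product is integrable),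
  `integrable_finprod_of_integrable_mul` (if `g ⊗ (∏ᶠ φ_i)` is integrable and `g` is not a.e. zero, the tensor product is integrable — Fubini slice), and
  **`integral_mul_finprod_eq_mul_tprod`**: `∫ g(x)·∏ᶠ_i φ_i(y_i) d(μ ⊗ ∏'ν) = (∫ g dμ) · ∏'_i ∫ φ_i dν_i` for `g ⊗ (∏ᶠ φ_i) ∈ L¹` (Mathlib `integral_prod_mul`
  + Tate; the degenerate branch `g =ᵐ 0` makes both sides `0`).
* §2 **`integral_unipDelta_eq_mul_tprod`** — ON `N_Δ(𝔸)`: for a Haar measure `νN`, local Haar measures `ν_v` (`ν_v(K_{H,v} ∩ N_Δ(L⁺_v)) = 1` off `S`), the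
  pinned splitting `ν_∞` of Φ3b (`hmap`), and an INTEGRABLE `G : N_Δ(𝔸) → ℂ` of shape (F)
  `G(u) = G_S(u_∞, (u_v)_{v∈S}) · ∏ᶠ_{v∉S} G_v(u_v)` with `G_v ≡ 1` on `K_{H,v} ∩ N_Δ(L⁺_v)`:
  `∫ G dνN = (∫ G_S d(ν_∞ ⊗ ⊗_{v∈S} ν_v)) · ∏'_{v∉S} ∫ G_v dν_v`, together with `hasProd_integral_unipDeltaLoc` (the Euler product CONVERGES to the
  `∏'` as soon as the tensor factor is integrable, e.g. when `G_S` is not a.e. zero — `integrable_finprod_unipDeltaLoc_of_not_ae_zero`).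
  Consumer: Φ3d (`G(u) = conj ψ_β(u) · f_s(w_Δ u h)`, factorizable by ★ #31s + Φ3a, integrable by ★ O41.3).
[cite: CasselsFrohlichANT1967, Ch. XV (Tate) §3.3 Thm. 3.3.1] [cite: BorelJacquet1979, §4.1] [cite: Tan1999, §2 (`M(s) = ⊗_v M_v(s)`)] [cite: KudlaRallis1994, §1]

HONEST LABEL: HC_CM is proved only modulo the 7 printed citations (2 remaining named inputs: hLiu418 = stmt-HodgeConjecture-24832,
h413 = stmt-HodgeConjecture-24833) until rung 0 closes; this file is a helper (`--supports stmt-HodgeConjecture-24832`) and closes no socket by itself.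

## References
* [CasselsFrohlichANT1967] J. W. S. Cassels, A. Fröhlich (eds.), *Algebraic Number Theory* (1967), Ch. XV (Tate) §3.3, Thm. 3.3.1.
* [BorelJacquet1979] A. Borel, H. Jacquet, PSPM 33.1 (1979), §4.1.
* [Tan1999] V. Tan, Canad. J. Math. 51 (1999), §2.
* [KudlaRallis1994] S. Kudla, S. Rallis, Ann. of Math. 140 (1994), §1.
-/

set_option autoImplicit false
-- the mandated namespace repeats the single-problem summit's segment (`HodgeConjecture.HodgeConjecture`)
set_option linter.dupNamespace false

noncomputable section

open scoped Matrix RestrictedProduct ENNReal NNReal Topology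
open NumberField IsDedekindDomain MeasureTheory Measure Filter Set

namespace Summit.HodgeConjecture.HodgeConjecture.Cruxes.HLiu418.K2LiuSiegelUnipotentEulerProduct

open Literature.NumberTheory.Automorphic Literature.NumberTheory.GaloisRepresentations
open Literature.NumberTheory.GelbartRogawski1991 Literature.NumberTheory.GelbartRogawski1991.GRConstruction
open Literature.NumberTheory.K2Lit.SiegelDoubled
open Literature.NumberTheory.K2Lit.PlaceSplitting
open Literature.MeasureTheory.RestrictedProduct
open Literature.Topology.Algebra.RestrictedProduct (inH)
open Summit.HodgeConjecture.HodgeConjecture.Cruxes.HLiu418.K2LiuAdelicPlaceSplittingFubini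
open Summit.HodgeConjecture.HodgeConjecture.Cruxes.HLiu418.K2LiuSiegelUnipotentLocalDefs
open Summit.HodgeConjecture.HodgeConjecture.Cruxes.HLiu418.K2LiuSiegelUnipotentSplitDefs
open Summit.HodgeConjecture.HodgeConjecture.Cruxes.HLiu418.K2LiuSiegelUnipotentSplitAtDefs
open Summit.HodgeConjecture.HodgeConjecture.Cruxes.HLiu418.K2LiuSiegelUnipotentHaarPinned

/-! ## §1 Generic: the Euler product of a restricted tensor product against `μ ⊗ ∏'(ν_i; K_i)` -/

section Generic

variable {ι : Type} {G : ι → Type} [∀ i, MeasurableSpace (G i)] [Countable ι]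
  (K : ∀ i, Set (G i)) (ν : ∀ i, Measure (G i)) [∀ i, SigmaFinite (ν i)]

omit [∀ i, MeasurableSpace (G i)] [Countable ι] [∀ i, SigmaFinite (ν i)] in
/-- On the box `A_T = {y | y_i ∈ K_i (i ∉ T)}` the restricted tensor product of local factors `φ_i ≡ 1` on `K_i` is the finite product over `T`.
[cite: CasselsFrohlichANT1967, Ch. XV (Tate) §3.3] -/
theorem finprod_eq_prod_of_mem_rpBox {R : Type} [CommMonoid R] (φ : ∀ i, G i → R) (hφK : ∀ i, ∀ k ∈ K i, φ i k = 1)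
    (T : Finset ι) {y : Πʳ i, [G i, K i]} (hy : y ∈ rpBox K T) :
    ∏ᶠ i, φ i (y i) = ∏ i ∈ T, φ i (y i) := by
  refine finprod_eq_prod_of_mulSupport_subset _ fun i hi => ?_
  rw [Finset.mem_coe]
  by_contra hiT
  exact hi (hφK i _ (hy i hiT))

/-- **Tate's Theorem 3.3.1 for a restricted tensor product, `HasProd` form**: if `y ↦ ∏ᶠ_i φ_i(y_i)` (`φ_i ≡ 1` on `K_i`, `ν_i(K_i) = 1`) is integrable for
`∏'(ν_i; K_i)`, then the Euler product `∏_i ∫ φ_i dν_i` CONVERGES (as a `HasProd` over all finite sets of indices) to its integral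
(★ `tendsto_prod_integral_of_forall_rpBox`). [cite: CasselsFrohlichANT1967, Ch. XV (Tate) §3.3 Thm. 3.3.1] -/
theorem hasProd_integral_of_integrable_finprod (hKne : ∀ i, (K i).Nonempty) (hKm : ∀ i, MeasurableSet (K i)) (hK1 : ∀ i, ν i (K i) = 1)
    (φ : ∀ i, G i → ℂ) (hφK : ∀ i, ∀ k ∈ K i, φ i k = 1)
    (hΦ : Integrable (fun y : Πʳ i, [G i, K i] => ∏ᶠ i, φ i (y i)) (rpMeasure K ν ∅)) :
    HasProd (fun i => ∫ y, φ i y ∂(ν i)) (∫ y, ∏ᶠ i, φ i (y i) ∂(rpMeasure K ν ∅)) :=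
  tendsto_prod_integral_of_forall_rpBox K ν hKne hKm (S₀ := ∅) (fun i _ => hK1 i) φ _
    (fun T _ _ hy => finprod_eq_prod_of_mem_rpBox K φ hφK T hy) hΦ

/-- **Integrability of the tensor factor**: if `(x, y) ↦ g(x) · ∏ᶠ_i φ_i(y_i)` is integrable for `μ ⊗ ∏'ν` and `g` is NOT a.e. zero, then
`y ↦ ∏ᶠ_i φ_i(y_i)` is integrable (a Fubini slice at a point `x` with `g(x) ≠ 0` and integrable slice). [cite: CasselsFrohlichANT1967, Ch. XV (Tate) §3.3] -/
theorem integrable_finprod_of_integrable_mul {X : Type} [MeasurableSpace X] (μ : Measure X) [SFinite μ]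
    (hKm : ∀ i, MeasurableSet (K i)) (hK1 : ∀ i, ν i (K i) = 1)
    (g : X → ℂ) (φ : ∀ i, G i → ℂ)
    (hint : Integrable (fun z : X × (Πʳ i, [G i, K i]) => g z.1 * ∏ᶠ i, φ i (z.2 i)) (μ.prod (rpMeasure K ν ∅)))
    (hg : ¬ g =ᵐ[μ] 0) :
    Integrable (fun y : Πʳ i, [G i, K i] => ∏ᶠ i, φ i (y i)) (rpMeasure K ν ∅) := by
  haveI : SigmaFinite (rpMeasure K ν ∅) := sigmaFinite_rpMeasure _ _ hKm (S₀ := ∅) (fun i _ => hK1 i)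
  have hsl : ∀ᵐ x ∂μ, Integrable (fun y : Πʳ i, [G i, K i] => g x * ∏ᶠ i, φ i (y i)) (rpMeasure K ν ∅) := hint.prod_right_ae
  by_contra hΦ
  apply hg
  filter_upwards [hsl] with x hx
  by_contra hgx
  exact hΦ (by simpa only [inv_mul_cancel_left₀ hgx] using hx.const_mul (g x)⁻¹)

/-- **THE EULER PRODUCT OF A RESTRICTED TENSOR PRODUCT (generic).**  For `μ ⊗ ∏'(ν_i; K_i)` (`ν_i(K_i) = 1`), `g : X → ℂ` and local factors `φ_i ≡ 1` on
`K_i` with `g ⊗ (∏ᶠ φ_i)` integrable: `∫ g(x)·∏ᶠ_i φ_i(y_i) = (∫ g dμ) · ∏'_i ∫ φ_i dν_i` (Mathlib `integral_prod_mul` + Tate 3.3.1; if `g =ᵐ 0` both sides vanish,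
otherwise the tensor factor is integrable and its integral is the convergent Euler product). [cite: CasselsFrohlichANT1967, Ch. XV (Tate) §3.3 Thm. 3.3.1] -/
theorem integral_mul_finprod_eq_mul_tprod {X : Type} [MeasurableSpace X] (μ : Measure X) [SFinite μ]
    (hKne : ∀ i, (K i).Nonempty) (hKm : ∀ i, MeasurableSet (K i)) (hK1 : ∀ i, ν i (K i) = 1)
    (g : X → ℂ) (φ : ∀ i, G i → ℂ) (hφK : ∀ i, ∀ k ∈ K i, φ i k = 1)
    (hint : Integrable (fun z : X × (Πʳ i, [G i, K i]) => g z.1 * ∏ᶠ i, φ i (z.2 i)) (μ.prod (rpMeasure K ν ∅))) :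
    ∫ z, g z.1 * ∏ᶠ i, φ i (z.2 i) ∂(μ.prod (rpMeasure K ν ∅)) = (∫ x, g x ∂μ) * ∏' i, ∫ y, φ i y ∂(ν i) := by
  haveI : SigmaFinite (rpMeasure K ν ∅) := sigmaFinite_rpMeasure _ _ hKm (S₀ := ∅) (fun i _ => hK1 i)
  rw [integral_prod_mul g (fun y : Πʳ i, [G i, K i] => ∏ᶠ i, φ i (y i))]
  by_cases hg : g =ᵐ[μ] 0
  · rw [integral_eq_zero_of_ae hg, zero_mul, zero_mul]
  · rw [(hasProd_integral_of_integrable_finprod K ν hKne hKm hK1 φ hφK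
      (integrable_finprod_of_integrable_mul K ν μ hKm hK1 g φ hint hg)).tprod_eq]

end Generic

/-! ## §2 On `N_Δ(𝔸)`: the Euler product of a factorizable integrable function -/

section UnipDelta

variable (L : Type) [Field L] [NumberField L] [IsCMField L]
variable {N M n : ℕ} (e : Fin N × Fin M ≃ Fin n)
  (dV : Fin N → L) (hdV : ∀ i, IsCMField.complexConj L (dV i) = dV i)
  (dW : Fin M → L) (hdW : ∀ i, IsCMField.complexConj L (dW i) = dW i)
  (S : Finset (HeightOneSpectrum (𝓞 (Fp L)))) [DecidableEq (HeightOneSpectrum (𝓞 (Fp L)))]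
  [MeasurableSpace ↥(unipDelta L e dV hdV dW hdW)] [BorelSpace ↥(unipDelta L e dV hdV dW hdW)]
  [MeasurableSpace ↥(unipDeltaArch L e dV hdV dW hdW)] [BorelSpace ↥(unipDeltaArch L e dV hdV dW hdW)]
  [∀ v : HeightOneSpectrum (𝓞 (Fp L)), MeasurableSpace ↥(unipDeltaLoc L e dV hdV dW hdW v)] [∀ v : HeightOneSpectrum (𝓞 (Fp L)), BorelSpace ↥(unipDeltaLoc L e dV hdV dW hdW v)]

omit [MeasurableSpace ↥(unipDelta L e dV hdV dW hdW)] [BorelSpace ↥(unipDelta L e dV hdV dW hdW)]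
  [MeasurableSpace ↥(unipDeltaArch L e dV hdV dW hdW)] [BorelSpace ↥(unipDeltaArch L e dV hdV dW hdW)]
  [∀ v : HeightOneSpectrum (𝓞 (Fp L)), MeasurableSpace ↥(unipDeltaLoc L e dV hdV dW hdW v)] [∀ v : HeightOneSpectrum (𝓞 (Fp L)), BorelSpace ↥(unipDeltaLoc L e dV hdV dW hdW v)] in
set_option synthInstance.maxHeartbeats 200000 in -- MEASURED: instance tower of the nested subtypes under the `∀ v` binder (as DEFS leaf 2)
set_option maxHeartbeats 800000 in -- MEASURED: `apply_symm_apply` unification on the same tower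
/-- **the transported integrand**: along the splitting `u ↦ (u_∞, (u_S, u^S))` a function of shape (F) becomes the tensor
`(a, x, y) ↦ G_S(a, x) · ∏ᶠ_{v∉S} G_v(y_v)` (`unipDeltaSplitAt_symm_apply`, coordinate lemmas of `unipDeltaSplit` ∕ ★ `glueS`). [cite: BorelJacquet1979, §4.1] -/
theorem apply_unipDeltaSplit_symm_eq
    (G : ↥(unipDelta L e dV hdV dW hdW) → ℂ) (GS : ↥(unipDeltaArch L e dV hdV dW hdW) × (Π v : S, ↥(unipDeltaLoc L e dV hdV dW hdW v.1)) → ℂ) (Gv : ∀ v : HeightOneSpectrum (𝓞 (Fp L)), ↥(unipDeltaLoc L e dV hdV dW hdW v) → ℂ)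
    (hF : ∀ u : ↥(unipDelta L e dV hdV dW hdW), G u =
      GS ((unipDeltaSplit L e dV hdV dW hdW u).1, fun v : S => (unipDeltaSplit L e dV hdV dW hdW u).2 v.1) *
        ∏ᶠ v : {v : HeightOneSpectrum (𝓞 (Fp L)) // v ∉ S}, Gv v.1 ((unipDeltaSplit L e dV hdV dW hdW u).2 v.1))
    (a : ↥(unipDeltaArch L e dV hdV dW hdW)) (x : (Π v : S, ↥(unipDeltaLoc L e dV hdV dW hdW v.1))) (y : (Πʳ v : {v : HeightOneSpectrum (𝓞 (Fp L)) // v ∉ S}, [↥(unipDeltaLoc L e dV hdV dW hdW v.1), inH (fun v => UnitaryGroup.localInt L (IsCMField.complexConj L) (n + n) (hermD L e dV hdV dW hdW) v) (fun v => unipDeltaLoc L e dV hdV dW hdW v) v.1])) :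
    G ((unipDeltaSplitAt L e dV hdV dW hdW S).symm (a, (x, y))) =
      GS (a, x) * ∏ᶠ v : {v : HeightOneSpectrum (𝓞 (Fp L)) // v ∉ S}, Gv v.1 (y v) := by
  have h0 : unipDeltaSplit L e dV hdV dW hdW ((unipDeltaSplit L e dV hdV dW hdW).symm (a, glueS (fun v => ↥(unipDeltaLoc L e dV hdV dW hdW v)) (fun v => inH (fun v => UnitaryGroup.localInt L (IsCMField.complexConj L) (n + n) (hermD L e dV hdV dW hdW) v) (fun v => unipDeltaLoc L e dV hdV dW hdW v) v) S (x, y))) =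
      (a, glueS (fun v => ↥(unipDeltaLoc L e dV hdV dW hdW v)) (fun v => inH (fun v => UnitaryGroup.localInt L (IsCMField.complexConj L) (n + n) (hermD L e dV hdV dW hdW) v) (fun v => unipDeltaLoc L e dV hdV dW hdW v) v) S (x, y)) := ContinuousMulEquiv.apply_symm_apply _ _
  rw [hF, unipDeltaSplitAt_symm_apply, h0]
  have hx : (fun v : S => (glueS (fun v => ↥(unipDeltaLoc L e dV hdV dW hdW v)) (fun v => inH (fun v => UnitaryGroup.localInt L (IsCMField.complexConj L) (n + n) (hermD L e dV hdV dW hdW) v) (fun v => unipDeltaLoc L e dV hdV dW hdW v) v) S (x, y)) v.1) = x := by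
    funext v
    rw [glueS_apply_of_mem _ _ _ _ v.2]
  have hy : ∀ v : {v : HeightOneSpectrum (𝓞 (Fp L)) // v ∉ S}, (glueS (fun v => ↥(unipDeltaLoc L e dV hdV dW hdW v)) (fun v => inH (fun v => UnitaryGroup.localInt L (IsCMField.complexConj L) (n + n) (hermD L e dV hdV dW hdW) v) (fun v => unipDeltaLoc L e dV hdV dW hdW v) v) S (x, y)) v.1 = y v := by
    intro v
    rw [glueS_apply_of_not_mem _ _ _ _ v.2]
  rw [hx]
  simp_rw [hy]

set_option maxHeartbeats 1600000 in -- MEASURED (as ★ Φ3b-3): `whnf` of the Haar∕Borel instance tower on `N_∞ × ((Π_{v∈S} N_v) × Πʳ_{v∉S} N_v)`; plain `rw`∕`exact`, no search tactics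
/-- **THE EULER PRODUCT ON `N_Δ(𝔸)`.**  `νN` a Haar measure on `N_Δ(𝔸)`, `ν_v` local Haar measures with `ν_v(K_{H,v} ∩ N_Δ(L⁺_v)) = 1` off `S`, `ν_∞` the pinned
archimedean factor (`hmap`, ★ Φ3b `exists_isHaarMeasure_map_unipDeltaSplit_eq_prod_pi_rpMeasure`); `G : N_Δ(𝔸) → ℂ` INTEGRABLE and of shape (F)
`G(u) = G_S(u_∞, (u_v)_{v∈S}) · ∏ᶠ_{v∉S} G_v(u_v)` with `G_v ≡ 1` on `K_{H,v} ∩ N_Δ(L⁺_v)`.  Then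
`∫_{N_Δ(𝔸)} G dνN = (∫ G_S d(ν_∞ ⊗ ⊗_{v∈S} ν_v)) · ∏'_{v∉S} ∫_{N_Δ(L⁺_v)} G_v dν_v`.
[cite: CasselsFrohlichANT1967, Ch. XV (Tate) §3.3 Thm. 3.3.1] [cite: BorelJacquet1979, §4.1] [cite: Tan1999, §2] -/
theorem integral_unipDelta_eq_mul_tprod
    (νN : Measure ↥(unipDelta L e dV hdV dW hdW)) (νv : ∀ v : HeightOneSpectrum (𝓞 (Fp L)), Measure ↥(unipDeltaLoc L e dV hdV dW hdW v)) [∀ v, (νv v).IsHaarMeasure]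
    [∀ v, SigmaFinite (νv v)]
    (hνK : ∀ v, v ∉ S → νv v (((inH (fun v => UnitaryGroup.localInt L (IsCMField.complexConj L) (n + n) (hermD L e dV hdV dW hdW) v) (fun v => unipDeltaLoc L e dV hdV dW hdW v) v) : Subgroup ↥(unipDeltaLoc L e dV hdV dW hdW v)) : Set ↥(unipDeltaLoc L e dV hdV dW hdW v)) = 1)
    (νinf : Measure ↥(unipDeltaArch L e dV hdV dW hdW)) [SigmaFinite νinf]
    (hmap : Measure.map (unipDeltaSplitAt L e dV hdV dW hdW S) νN =
      νinf.prod ((Measure.pi fun v : S => νv v.1).prod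
        (rpMeasure (fun v : {v : HeightOneSpectrum (𝓞 (Fp L)) // v ∉ S} => ((inH (fun v => UnitaryGroup.localInt L (IsCMField.complexConj L) (n + n) (hermD L e dV hdV dW hdW) v) (fun v => unipDeltaLoc L e dV hdV dW hdW v) v.1 : Subgroup ↥(unipDeltaLoc L e dV hdV dW hdW v.1)) : Set ↥(unipDeltaLoc L e dV hdV dW hdW v.1))) (fun v => νv v.1) ∅)))
    (G : ↥(unipDelta L e dV hdV dW hdW) → ℂ) (hG : Integrable G νN)
    (GS : ↥(unipDeltaArch L e dV hdV dW hdW) × (Π v : S, ↥(unipDeltaLoc L e dV hdV dW hdW v.1)) → ℂ) (Gv : ∀ v : HeightOneSpectrum (𝓞 (Fp L)), ↥(unipDeltaLoc L e dV hdV dW hdW v) → ℂ)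
    (hF : ∀ u : ↥(unipDelta L e dV hdV dW hdW), G u =
      GS ((unipDeltaSplit L e dV hdV dW hdW u).1, fun v : S => (unipDeltaSplit L e dV hdV dW hdW u).2 v.1) *
        ∏ᶠ v : {v : HeightOneSpectrum (𝓞 (Fp L)) // v ∉ S}, Gv v.1 ((unipDeltaSplit L e dV hdV dW hdW u).2 v.1))
    (hGK : ∀ v, v ∉ S → ∀ k : ↥(unipDeltaLoc L e dV hdV dW hdW v), k ∈ (inH (fun v => UnitaryGroup.localInt L (IsCMField.complexConj L) (n + n) (hermD L e dV hdV dW hdW) v) (fun v => unipDeltaLoc L e dV hdV dW hdW v) v) → Gv v k = 1) :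
    Integrable (fun z : (↥(unipDeltaArch L e dV hdV dW hdW) × (Π v : S, ↥(unipDeltaLoc L e dV hdV dW hdW v.1))) × (Πʳ v : {v : HeightOneSpectrum (𝓞 (Fp L)) // v ∉ S}, [↥(unipDeltaLoc L e dV hdV dW hdW v.1), inH (fun v => UnitaryGroup.localInt L (IsCMField.complexConj L) (n + n) (hermD L e dV hdV dW hdW) v) (fun v => unipDeltaLoc L e dV hdV dW hdW v) v.1]) =>
        GS z.1 * ∏ᶠ v : {v : HeightOneSpectrum (𝓞 (Fp L)) // v ∉ S}, Gv v.1 (z.2 v))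
      ((νinf.prod (Measure.pi fun v : S => νv v.1)).prod (rpMeasure (fun v : {v : HeightOneSpectrum (𝓞 (Fp L)) // v ∉ S} => ((inH (fun v => UnitaryGroup.localInt L (IsCMField.complexConj L) (n + n) (hermD L e dV hdV dW hdW) v) (fun v => unipDeltaLoc L e dV hdV dW hdW v) v.1 : Subgroup ↥(unipDeltaLoc L e dV hdV dW hdW v.1)) : Set ↥(unipDeltaLoc L e dV hdV dW hdW v.1))) (fun v => νv v.1) ∅)) ∧
    ∫ u, G u ∂νN =
      (∫ p, GS p ∂(νinf.prod (Measure.pi fun v : S => νv v.1))) *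
        ∏' v : {v : HeightOneSpectrum (𝓞 (Fp L)) // v ∉ S}, ∫ y, Gv v.1 y ∂(νv v.1) := by
  haveI : Countable (HeightOneSpectrum (𝓞 (Fp L))) := countable_heightOneSpectrum (Fp L)
  haveI : ∀ v, SecondCountableTopology ↥(unipDeltaLoc L e dV hdV dW hdW v) := fun v => secondCountableTopology_unipDeltaLoc L e dV hdV dW hdW v
  haveI := fact_isOpen_inH_unipDeltaLoc L e dV hdV dW hdW
  haveI := fact_isOpen_off (fun v => ↥(unipDeltaLoc L e dV hdV dW hdW v)) (fun v => inH (fun v => UnitaryGroup.localInt L (IsCMField.complexConj L) (n + n) (hermD L e dV hdV dW hdW) v) (fun v => unipDeltaLoc L e dV hdV dW hdW v) v) S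
  haveI := borelSpace_off (fun v => ↥(unipDeltaLoc L e dV hdV dW hdW v)) (fun v => inH (fun v => UnitaryGroup.localInt L (IsCMField.complexConj L) (n + n) (hermD L e dV hdV dW hdW) v) (fun v => unipDeltaLoc L e dV hdV dW hdW v) v) S
  haveI := secondCountableTopology_off (fun v => ↥(unipDeltaLoc L e dV hdV dW hdW v)) (fun v => inH (fun v => UnitaryGroup.localInt L (IsCMField.complexConj L) (n + n) (hermD L e dV hdV dW hdW) v) (fun v => unipDeltaLoc L e dV hdV dW hdW v) v) S
  have hKne : ∀ v : {v : HeightOneSpectrum (𝓞 (Fp L)) // v ∉ S},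
      (((inH (fun v => UnitaryGroup.localInt L (IsCMField.complexConj L) (n + n) (hermD L e dV hdV dW hdW) v) (fun v => unipDeltaLoc L e dV hdV dW hdW v) v.1) : Subgroup ↥(unipDeltaLoc L e dV hdV dW hdW v.1)) : Set ↥(unipDeltaLoc L e dV hdV dW hdW v.1)).Nonempty := fun v => ⟨1, Subgroup.one_mem _⟩
  have hKm : ∀ v : {v : HeightOneSpectrum (𝓞 (Fp L)) // v ∉ S},
      MeasurableSet (((inH (fun v => UnitaryGroup.localInt L (IsCMField.complexConj L) (n + n) (hermD L e dV hdV dW hdW) v) (fun v => unipDeltaLoc L e dV hdV dW hdW v) v.1) : Subgroup ↥(unipDeltaLoc L e dV hdV dW hdW v.1)) : Set ↥(unipDeltaLoc L e dV hdV dW hdW v.1)) :=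
    fun v => (isOpen_inH_unipDeltaLoc L e dV hdV dW hdW v.1).measurableSet
  haveI : SigmaFinite (rpMeasure (fun v : {v : HeightOneSpectrum (𝓞 (Fp L)) // v ∉ S} => ((inH (fun v => UnitaryGroup.localInt L (IsCMField.complexConj L) (n + n) (hermD L e dV hdV dW hdW) v) (fun v => unipDeltaLoc L e dV hdV dW hdW v) v.1 : Subgroup ↥(unipDeltaLoc L e dV hdV dW hdW v.1)) : Set ↥(unipDeltaLoc L e dV hdV dW hdW v.1))) (fun v => νv v.1) ∅) :=
    sigmaFinite_rpMeasure _ _ hKm (S₀ := ∅) (fun v _ => hνK v.1 v.2)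
  haveI := secondCountableTopology_unipDeltaArch L e dV hdV dW hdW
  haveI hS2 : SecondCountableTopology (Π v : S, ↥(unipDeltaLoc L e dV hdV dW hdW v.1)) := inferInstance
  haveI : SecondCountableTopologyEither (Π v : S, ↥(unipDeltaLoc L e dV hdV dW hdW v.1)) (Πʳ v : {v : HeightOneSpectrum (𝓞 (Fp L)) // v ∉ S}, [↥(unipDeltaLoc L e dV hdV dW hdW v.1), inH (fun v => UnitaryGroup.localInt L (IsCMField.complexConj L) (n + n) (hermD L e dV hdV dW hdW) v) (fun v => unipDeltaLoc L e dV hdV dW hdW v) v.1]) := secondCountableTopologyEither_of_left _ _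
  haveI : BorelSpace ((Π v : S, ↥(unipDeltaLoc L e dV hdV dW hdW v.1)) × (Πʳ v : {v : HeightOneSpectrum (𝓞 (Fp L)) // v ∉ S}, [↥(unipDeltaLoc L e dV hdV dW hdW v.1), inH (fun v => UnitaryGroup.localInt L (IsCMField.complexConj L) (n + n) (hermD L e dV hdV dW hdW) v) (fun v => unipDeltaLoc L e dV hdV dW hdW v) v.1])) := Prod.borelSpace
  haveI : SecondCountableTopologyEither ↥(unipDeltaArch L e dV hdV dW hdW) ((Π v : S, ↥(unipDeltaLoc L e dV hdV dW hdW v.1)) × (Πʳ v : {v : HeightOneSpectrum (𝓞 (Fp L)) // v ∉ S}, [↥(unipDeltaLoc L e dV hdV dW hdW v.1), inH (fun v => UnitaryGroup.localInt L (IsCMField.complexConj L) (n + n) (hermD L e dV hdV dW hdW) v) (fun v => unipDeltaLoc L e dV hdV dW hdW v) v.1])) := secondCountableTopologyEither_of_right _ _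
  haveI : BorelSpace (↥(unipDeltaArch L e dV hdV dW hdW) × ((Π v : S, ↥(unipDeltaLoc L e dV hdV dW hdW v.1)) × (Πʳ v : {v : HeightOneSpectrum (𝓞 (Fp L)) // v ∉ S}, [↥(unipDeltaLoc L e dV hdV dW hdW v.1), inH (fun v => UnitaryGroup.localInt L (IsCMField.complexConj L) (n + n) (hermD L e dV hdV dW hdW) v) (fun v => unipDeltaLoc L e dV hdV dW hdW v) v.1]))) := Prod.borelSpace
  -- the transport of `G` along the named splitting `unipDeltaSplitAt S`
  have hE : Measure.map (unipDeltaSplitAt L e dV hdV dW hdW S) νN = νinf.prod ((Measure.pi fun v : S => νv v.1).prod (rpMeasure (fun v : {v : HeightOneSpectrum (𝓞 (Fp L)) // v ∉ S} => ((inH (fun v => UnitaryGroup.localInt L (IsCMField.complexConj L) (n + n) (hermD L e dV hdV dW hdW) v) (fun v => unipDeltaLoc L e dV hdV dW hdW v) v.1 : Subgroup ↥(unipDeltaLoc L e dV hdV dW hdW v.1)) : Set ↥(unipDeltaLoc L e dV hdV dW hdW v.1))) (fun v => νv v.1) ∅)) := hmap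
  have hmpE : MeasurePreserving (unipDeltaSplitAt L e dV hdV dW hdW S) νN (νinf.prod ((Measure.pi fun v : S => νv v.1).prod (rpMeasure (fun v : {v : HeightOneSpectrum (𝓞 (Fp L)) // v ∉ S} => ((inH (fun v => UnitaryGroup.localInt L (IsCMField.complexConj L) (n + n) (hermD L e dV hdV dW hdW) v) (fun v => unipDeltaLoc L e dV hdV dW hdW v) v.1 : Subgroup ↥(unipDeltaLoc L e dV hdV dW hdW v.1)) : Set ↥(unipDeltaLoc L e dV hdV dW hdW v.1))) (fun v => νv v.1) ∅))) := ⟨(unipDeltaSplitAt L e dV hdV dW hdW S).continuous.measurable, hE⟩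
  have hsymm := hmpE.symm (unipDeltaSplitAt L e dV hdV dW hdW S).toHomeomorph.toMeasurableEquiv
  have hGE : ∀ z, G ((unipDeltaSplitAt L e dV hdV dW hdW S).symm z) = GS (z.1, z.2.1) * ∏ᶠ v : {v : HeightOneSpectrum (𝓞 (Fp L)) // v ∉ S}, Gv v.1 (z.2.2 v) := fun z =>
    apply_unipDeltaSplit_symm_eq L e dV hdV dW hdW S G GS Gv hF z.1 z.2.1 z.2.2
  have hint : Integrable (fun z => G ((unipDeltaSplitAt L e dV hdV dW hdW S).symm z)) (νinf.prod ((Measure.pi fun v : S => νv v.1).prod (rpMeasure (fun v : {v : HeightOneSpectrum (𝓞 (Fp L)) // v ∉ S} => ((inH (fun v => UnitaryGroup.localInt L (IsCMField.complexConj L) (n + n) (hermD L e dV hdV dW hdW) v) (fun v => unipDeltaLoc L e dV hdV dW hdW v) v.1 : Subgroup ↥(unipDeltaLoc L e dV hdV dW hdW v.1)) : Set ↥(unipDeltaLoc L e dV hdV dW hdW v.1))) (fun v => νv v.1) ∅))) :=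
    (hsymm.integrable_comp_emb (unipDeltaSplitAt L e dV hdV dW hdW S).symm.toHomeomorph.toMeasurableEquiv.measurableEmbedding).2 hG
  -- reassociate `ν_∞ ⊗ (ν_S ⊗ ν^S) ≅ (ν_∞ ⊗ ν_S) ⊗ ν^S`
  have hassoc := MeasureTheory.measurePreserving_prodAssoc νinf (Measure.pi fun v : S => νv v.1) (rpMeasure (fun v : {v : HeightOneSpectrum (𝓞 (Fp L)) // v ∉ S} => ((inH (fun v => UnitaryGroup.localInt L (IsCMField.complexConj L) (n + n) (hermD L e dV hdV dW hdW) v) (fun v => unipDeltaLoc L e dV hdV dW hdW v) v.1 : Subgroup ↥(unipDeltaLoc L e dV hdV dW hdW v.1)) : Set ↥(unipDeltaLoc L e dV hdV dW hdW v.1))) (fun v => νv v.1) ∅)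
  have hint' : Integrable (fun w : (↥(unipDeltaArch L e dV hdV dW hdW) × (Π v : S, ↥(unipDeltaLoc L e dV hdV dW hdW v.1))) × (Πʳ v : {v : HeightOneSpectrum (𝓞 (Fp L)) // v ∉ S}, [↥(unipDeltaLoc L e dV hdV dW hdW v.1), inH (fun v => UnitaryGroup.localInt L (IsCMField.complexConj L) (n + n) (hermD L e dV hdV dW hdW) v) (fun v => unipDeltaLoc L e dV hdV dW hdW v) v.1]) => G ((unipDeltaSplitAt L e dV hdV dW hdW S).symm (MeasurableEquiv.prodAssoc w)))
      ((νinf.prod (Measure.pi fun v : S => νv v.1)).prod (rpMeasure (fun v : {v : HeightOneSpectrum (𝓞 (Fp L)) // v ∉ S} => ((inH (fun v => UnitaryGroup.localInt L (IsCMField.complexConj L) (n + n) (hermD L e dV hdV dW hdW) v) (fun v => unipDeltaLoc L e dV hdV dW hdW v) v.1 : Subgroup ↥(unipDeltaLoc L e dV hdV dW hdW v.1)) : Set ↥(unipDeltaLoc L e dV hdV dW hdW v.1))) (fun v => νv v.1) ∅)) :=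
    (hassoc.integrable_comp_emb MeasurableEquiv.prodAssoc.measurableEmbedding).2 hint
  have hfun : (fun w : (↥(unipDeltaArch L e dV hdV dW hdW) × (Π v : S, ↥(unipDeltaLoc L e dV hdV dW hdW v.1))) × (Πʳ v : {v : HeightOneSpectrum (𝓞 (Fp L)) // v ∉ S}, [↥(unipDeltaLoc L e dV hdV dW hdW v.1), inH (fun v => UnitaryGroup.localInt L (IsCMField.complexConj L) (n + n) (hermD L e dV hdV dW hdW) v) (fun v => unipDeltaLoc L e dV hdV dW hdW v) v.1]) => G ((unipDeltaSplitAt L e dV hdV dW hdW S).symm (MeasurableEquiv.prodAssoc w))) =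
      fun z => GS z.1 * ∏ᶠ v : {v : HeightOneSpectrum (𝓞 (Fp L)) // v ∉ S}, Gv v.1 (z.2 v) := by
    funext w
    exact hGE _
  rw [hfun] at hint'
  refine ⟨hint', ?_⟩
  -- transport the integral and apply the generic Euler product
  have h1 : ∫ u, G u ∂νN = ∫ z, G ((unipDeltaSplitAt L e dV hdV dW hdW S).symm z) ∂(νinf.prod ((Measure.pi fun v : S => νv v.1).prod (rpMeasure (fun v : {v : HeightOneSpectrum (𝓞 (Fp L)) // v ∉ S} => ((inH (fun v => UnitaryGroup.localInt L (IsCMField.complexConj L) (n + n) (hermD L e dV hdV dW hdW) v) (fun v => unipDeltaLoc L e dV hdV dW hdW v) v.1 : Subgroup ↥(unipDeltaLoc L e dV hdV dW hdW v.1)) : Set ↥(unipDeltaLoc L e dV hdV dW hdW v.1))) (fun v => νv v.1) ∅))) := by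
    have hcoe : ⇑((unipDeltaSplitAt L e dV hdV dW hdW S).toHomeomorph.toMeasurableEquiv) =
        ⇑(unipDeltaSplitAt L e dV hdV dW hdW S) := Homeomorph.toMeasurableEquiv_coe _
    rw [← hE, ← hcoe, integral_map_equiv]
    exact integral_congr_ae (Filter.Eventually.of_forall fun u => by
      simp only [hcoe, ContinuousMulEquiv.symm_apply_apply])
  have h2 : ∫ z, G ((unipDeltaSplitAt L e dV hdV dW hdW S).symm z) ∂(νinf.prod ((Measure.pi fun v : S => νv v.1).prod (rpMeasure (fun v : {v : HeightOneSpectrum (𝓞 (Fp L)) // v ∉ S} => ((inH (fun v => UnitaryGroup.localInt L (IsCMField.complexConj L) (n + n) (hermD L e dV hdV dW hdW) v) (fun v => unipDeltaLoc L e dV hdV dW hdW v) v.1 : Subgroup ↥(unipDeltaLoc L e dV hdV dW hdW v.1)) : Set ↥(unipDeltaLoc L e dV hdV dW hdW v.1))) (fun v => νv v.1) ∅))) =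
      ∫ w, G ((unipDeltaSplitAt L e dV hdV dW hdW S).symm (MeasurableEquiv.prodAssoc w)) ∂((νinf.prod (Measure.pi fun v : S => νv v.1)).prod (rpMeasure (fun v : {v : HeightOneSpectrum (𝓞 (Fp L)) // v ∉ S} => ((inH (fun v => UnitaryGroup.localInt L (IsCMField.complexConj L) (n + n) (hermD L e dV hdV dW hdW) v) (fun v => unipDeltaLoc L e dV hdV dW hdW v) v.1 : Subgroup ↥(unipDeltaLoc L e dV hdV dW hdW v.1)) : Set ↥(unipDeltaLoc L e dV hdV dW hdW v.1))) (fun v => νv v.1) ∅)) :=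
    (hassoc.integral_comp' (fun z => G ((unipDeltaSplitAt L e dV hdV dW hdW S).symm z))).symm
  rw [h1, h2, hfun]
  exact integral_mul_finprod_eq_mul_tprod
    (fun v : {v : HeightOneSpectrum (𝓞 (Fp L)) // v ∉ S} => (((inH (fun v => UnitaryGroup.localInt L (IsCMField.complexConj L) (n + n) (hermD L e dV hdV dW hdW) v) (fun v => unipDeltaLoc L e dV hdV dW hdW v) v.1) : Subgroup ↥(unipDeltaLoc L e dV hdV dW hdW v.1)) : Set ↥(unipDeltaLoc L e dV hdV dW hdW v.1)))
    (fun v => νv v.1) _ hKne hKm (fun v => hνK v.1 v.2) GS (fun v => Gv v.1) (fun v k hk => hGK v.1 v.2 k hk) hint'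

omit [DecidableEq (HeightOneSpectrum (𝓞 (Fp L)))] [MeasurableSpace ↥(unipDelta L e dV hdV dW hdW)] [BorelSpace ↥(unipDelta L e dV hdV dW hdW)]
  [MeasurableSpace ↥(unipDeltaArch L e dV hdV dW hdW)] [BorelSpace ↥(unipDeltaArch L e dV hdV dW hdW)] in
/-- **CONVERGENCE OF THE EULER PRODUCT ON `N_Δ(𝔸)`**: in the situation of `integral_unipDelta_eq_mul_tprod`, if the tensor factor
`y ↦ ∏ᶠ_{v∉S} G_v(y_v)` is integrable for `∏'_{v∉S}(ν_v; K_{H,v} ∩ N_Δ(L⁺_v))` — e.g. when `G_S` is not a.e. zero (`integrable_finprod_of_integrable_mul`) — then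
`∏_{v∉S} ∫ G_v dν_v` converges to `∫ ∏ᶠ G_v` as a `HasProd`. [cite: CasselsFrohlichANT1967, Ch. XV (Tate) §3.3 Thm. 3.3.1] -/
theorem hasProd_integral_unipDeltaLoc
    (νv : ∀ v : HeightOneSpectrum (𝓞 (Fp L)), Measure ↥(unipDeltaLoc L e dV hdV dW hdW v)) [∀ v, (νv v).IsHaarMeasure]
    [∀ v, SigmaFinite (νv v)]
    (hνK : ∀ v, v ∉ S → νv v (((inH (fun v => UnitaryGroup.localInt L (IsCMField.complexConj L) (n + n) (hermD L e dV hdV dW hdW) v) (fun v => unipDeltaLoc L e dV hdV dW hdW v) v) : Subgroup ↥(unipDeltaLoc L e dV hdV dW hdW v)) : Set ↥(unipDeltaLoc L e dV hdV dW hdW v)) = 1)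
    (Gv : ∀ v : HeightOneSpectrum (𝓞 (Fp L)), ↥(unipDeltaLoc L e dV hdV dW hdW v) → ℂ)
    (hGK : ∀ v, v ∉ S → ∀ k : ↥(unipDeltaLoc L e dV hdV dW hdW v), k ∈ (inH (fun v => UnitaryGroup.localInt L (IsCMField.complexConj L) (n + n) (hermD L e dV hdV dW hdW) v) (fun v => unipDeltaLoc L e dV hdV dW hdW v) v) → Gv v k = 1)
    (hΦ : Integrable (fun y : (Πʳ v : {v : HeightOneSpectrum (𝓞 (Fp L)) // v ∉ S}, [↥(unipDeltaLoc L e dV hdV dW hdW v.1), inH (fun v => UnitaryGroup.localInt L (IsCMField.complexConj L) (n + n) (hermD L e dV hdV dW hdW) v) (fun v => unipDeltaLoc L e dV hdV dW hdW v) v.1]) => ∏ᶠ v : {v : HeightOneSpectrum (𝓞 (Fp L)) // v ∉ S}, Gv v.1 (y v))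
      (rpMeasure (fun v : {v : HeightOneSpectrum (𝓞 (Fp L)) // v ∉ S} => ((inH (fun v => UnitaryGroup.localInt L (IsCMField.complexConj L) (n + n) (hermD L e dV hdV dW hdW) v) (fun v => unipDeltaLoc L e dV hdV dW hdW v) v.1 : Subgroup ↥(unipDeltaLoc L e dV hdV dW hdW v.1)) : Set ↥(unipDeltaLoc L e dV hdV dW hdW v.1))) (fun v => νv v.1) ∅)) :
    HasProd (fun v : {v : HeightOneSpectrum (𝓞 (Fp L)) // v ∉ S} => ∫ y, Gv v.1 y ∂(νv v.1))
      (∫ y, ∏ᶠ v : {v : HeightOneSpectrum (𝓞 (Fp L)) // v ∉ S}, Gv v.1 (y v) ∂(rpMeasure (fun v : {v : HeightOneSpectrum (𝓞 (Fp L)) // v ∉ S} => ((inH (fun v => UnitaryGroup.localInt L (IsCMField.complexConj L) (n + n) (hermD L e dV hdV dW hdW) v) (fun v => unipDeltaLoc L e dV hdV dW hdW v) v.1 : Subgroup ↥(unipDeltaLoc L e dV hdV dW hdW v.1)) : Set ↥(unipDeltaLoc L e dV hdV dW hdW v.1))) (fun v => νv v.1) ∅)) := by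
  haveI : Countable (HeightOneSpectrum (𝓞 (Fp L))) := countable_heightOneSpectrum (Fp L)
  exact hasProd_integral_of_integrable_finprod
    (fun v : {v : HeightOneSpectrum (𝓞 (Fp L)) // v ∉ S} => (((inH (fun v => UnitaryGroup.localInt L (IsCMField.complexConj L) (n + n) (hermD L e dV hdV dW hdW) v) (fun v => unipDeltaLoc L e dV hdV dW hdW v) v.1) : Subgroup ↥(unipDeltaLoc L e dV hdV dW hdW v.1)) : Set ↥(unipDeltaLoc L e dV hdV dW hdW v.1)))
    (fun v => νv v.1) (fun v => ⟨1, Subgroup.one_mem _⟩) (fun v => (isOpen_inH_unipDeltaLoc L e dV hdV dW hdW v.1).measurableSet)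
    (fun v => hνK v.1 v.2) (fun v => Gv v.1) (fun v k hk => hGK v.1 v.2 k hk) hΦ

end UnipDelta

end Summit.HodgeConjecture.HodgeConjecture.Cruxes.HLiu418.K2LiuSiegelUnipotentEulerProduct

end
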